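import Summits.HubbardSuperconductivity.HubbardSuperconductivity.Theorems.BalabanIRBirComplexStableXYRInfraredEndgame
import Summits.HubbardSuperconductivity.HubbardSuperconductivity.Theorems.BalabanIRBirSliceXYOrderRP
import Summits.HubbardSuperconductivity.HubbardSuperconductivity.Theorems.BirComplexStableXY.Negative.BirComplexStableXYFalseOfWitnessZeroExists
import HarnessLib

/-!
# BalabanIR crux 2R `BirComplexStableXYR` (stmt-HubbardSuperconductivity-14845), line `fat-gaussian-defect-calculus`:
# the complex infrared bound S5b CALIBRATED on the XY table

Support file for stub S5b `stub_complexInfraredBound` of `Cruxes/BirComplexStableXYR/Lines/fat_gaussian_defect_calculus.lean`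
(lead c6).  S5b asks, for every admissible complex window table `c`, `K ≥ K₀(r,B,c₀)`, even `L₀ ≤ L ≤ M`, every spatial
momentum `k ≠ 0` and temporal momentum `q`, for the INFRARED BOUND per space-time mode of the complex measure `e^{−A}dθ`
on `Λ = (ℤ/L)² × ℤ/M`: `Re ∫ |ẑ_θ(k,q)|² e^{−A} ≤ C·L²M/(c₀K(ε_L(k)+ε_M(q))) · Re Z`, `ẑ_θ(k,q) = Σ_s e^{iθ_s}χ_k(s₁)χ_q(s₂)`,
with `C` independent of `K, L, M`.  Here we prove exactly this conclusion, with these normalisations, for the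
S5b-admissible (`witness_admissible`: (U1), (N), (A) with `B = 128`, (C) with `c₀ = 1/18`) nearest-neighbour XY table
`witness 0 0` (`r = 2`) of `Theorems.BirComplexStableXY.Negative.WitnessTable`, for EVERY `K > 0` and all even `L, M ≥ 4`,
with the spin-wave constant: `Re ∫ |ẑ_θ(k,q)|² e^{−A} ≤ L²M/(2K(ε_L(k)+ε_M(q))) · Re Z`, i.e. S5b's shape with `C = c₀/2`
(`xyWitness_complexInfraredBound`) — the statement-sanity check of the stub (constant `K`-, `L`-, `M`-independent,
dispersion to the first power) and the `r = 2` real calibration point of the engine's second output.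

Proof: the window action of `witness 0 0` counts every nearest-neighbour bond of `Λ` four times (`xyw_sum_S12`:
`Σ_s S12(θ∘sh s) = 12L²M − 4E(θ)`), so `e^{−A} = e^{−12KL²M}e^{4K·E(θ)}` is the XY Gibbs factor at stiffness `J = 4K`
(`xyw_cexp_neg_action`); in the unit-vector dictionary of `BirSliceXYOrderRP` this is `e^{3JL²M}e^{−(J/2)𝓔(ω,ω)}`, and
the Fröhlich–Simon–Spencer infrared bound per spin component on the anisotropic torus (`BirSliceXY.weighted_mode_bound_box`,
reflection positivity + Gaussian domination, `β = J/2`) with `|ẑ|² ≤ 2|ω̂⁰|² + 2|ω̂¹|²` gives `βε ∫ w|ẑ|² ≤ |Λ| ∫ w`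
(`xy_modeBound_pi`), i.e. `ε ∫ |ẑ|² e^{JE} ≤ (2|Λ|/J) ∫ e^{JE}` on the angle cube (`xy_modeBound_cube`).
References: Fröhlich–Simon–Spencer, Comm. Math. Phys. 50 (1976) 79–95, Thm. 3.1 [FrohlichSimonSpencer1976];
Friedli–Velenik, *Statistical Mechanics of Lattice Systems*, CUP 2017, Thm. 10.24, §10.5.2 [FriedliVelenik2017].
-/

set_option linter.dupNamespace false -- summit = problem name (single-conjunct summit), D-0017

noncomputable section

namespace Summit.HubbardSuperconductivity.HubbardSuperconductivity.Theorems

open scoped BigOperators ComplexConjugate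
open MeasureTheory Literature.Probability.LatticeModels Complex
open Summit.HubbardSuperconductivity.BirComplexStableXYNegative

section ModeBound

variable {d d' L M : ℕ} [NeZero L] [NeZero M]

omit [NeZero M] in
/-- `ε_L(k) + ε_M(q) > 0` for a nonzero spatial momentum `k`. [folklore] -/
theorem xy_dispersion_pos (k : TorusSite d L) (hk : k ≠ 0) (q : TorusSite d' M) :
    0 < dispersion (latticeMomentum L k) + dispersion (latticeMomentum M q) :=
  add_pos_of_pos_of_nonneg (lt_of_le_of_ne (dispersion_nonneg _)
    (fun h => hk ((dispersion_latticeMomentum_eq_zero_iff_holds k).1 h.symm))) (dispersion_nonneg _)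

/-- **Infrared bound per space-time mode for the XY weight, weighted form** on the product torus
`(ℤ/L)^d × (ℤ/M)^{d'}` (`L, M ≥ 4` even): with `w = e^{−β𝓔(ω,ω)}`, `z_p = ω_p⁰ + iω_p¹` and `k ≠ 0`,
`βε(k,q) ∫ w|Σ_p z_pχ_{k,q}(p)|² dμ₀ ≤ |Λ| ∫ w dμ₀` — the tree's bound per spin component
(`BirSliceXY.weighted_mode_bound_box`, Fröhlich–Simon–Spencer 1976 / Friedli–Velenik Thm. 10.24) and
`|ẑ|² ≤ 2|ω̂⁰|² + 2|ω̂¹|²`. [cite: FriedliVelenik2017, Thm. 10.24 and §10.5.2] -/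
theorem xy_modeBound_pi [DecidableRel (torusGraph d L □ torusGraph d' M).Adj]
    (hL : Even L) (hL4 : 4 ≤ L) (hM : Even M) (hM4 : 4 ≤ M) (ρ : Measure (Fin 2 → ℝ))
    [IsFiniteMeasure ρ] {Kc : Set (Fin 2 → ℝ)} (hKc : IsCompact Kc) (hK : ρ Kcᶜ = 0) (hρ : ρ ≠ 0)
    {β : ℝ} (hβ : 0 < β) (k : TorusSite d L) (hk : k ≠ 0) (q : TorusSite d' M) :
    β * (dispersion (latticeMomentum L k) + dispersion (latticeMomentum M q)) *
        ∫ ω, Real.exp (-β * NVector.vecGradForm (torusGraph d L □ torusGraph d' M) ω ω) *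
          ‖∑ p : TorusSite d L × TorusSite d' M,
              ((ω p 0 : ℂ) + (ω p 1 : ℂ) * I) * (torusChar k p.1 * torusChar q p.2)‖ ^ 2
            ∂(Measure.pi fun _ : TorusSite d L × TorusSite d' M => ρ) ≤
      ((L : ℝ) ^ d * (M : ℝ) ^ d') *
        ∫ ω, Real.exp (-β * NVector.vecGradForm (torusGraph d L □ torusGraph d' M) ω ω)
          ∂(Measure.pi fun _ : TorusSite d L × TorusSite d' M => ρ) := by
  set μ₀ : Measure (TorusSite d L × TorusSite d' M → Fin 2 → ℝ) :=
    Measure.pi fun _ : TorusSite d L × TorusSite d' M => ρ with hμ₀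
  set w : (TorusSite d L × TorusSite d' M → Fin 2 → ℝ) → ℝ := fun ω =>
    Real.exp (-β * NVector.vecGradForm (torusGraph d L □ torusGraph d' M) ω ω) with hw
  set Z₀ : ℝ := ∫ ω, w ω ∂μ₀ with hZ₀
  set md : (TorusSite d L × TorusSite d' M → Fin 2 → ℝ) → ℂ := fun ω =>
    ∑ p : TorusSite d L × TorusSite d' M,
      ((ω p 0 : ℂ) + (ω p 1 : ℂ) * I) * (torusChar k p.1 * torusChar q p.2) with hmd
  set mc : (TorusSite d L × TorusSite d' M → Fin 2 → ℝ) → Fin 2 → ℂ := fun ω a =>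
    ∑ p : TorusSite d L × TorusSite d' M, (ω p a : ℂ) * (torusChar k p.1 * torusChar q p.2) with hmc
  set ε : ℝ := dispersion (latticeMomentum L k) + dispersion (latticeMomentum M q)
  show β * ε * ∫ ω, w ω * ‖md ω‖ ^ 2 ∂μ₀ ≤ ((L : ℝ) ^ d * (M : ℝ) ^ d') * Z₀
  have hwc : Continuous w :=
    ((NVector.continuous_vecGradForm_self (G := torusGraph d L □ torusGraph d' M)).const_mul (-β)).rexp
  have hint : ∀ {f : (TorusSite d L × TorusSite d' M → Fin 2 → ℝ) → ℝ}, Continuous f →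
      Integrable f μ₀ := fun hf => NVector.integrable_pi_of_continuous ρ hKc hK hf
  have hmdc : Continuous fun ω => ‖md ω‖ ^ 2 := by rw [hmd]; fun_prop
  have hmcc : ∀ a, Continuous fun ω => ‖mc ω a‖ ^ 2 := by intro a; rw [hmc]; fun_prop
  have hImd : Integrable (fun ω => w ω * ‖md ω‖ ^ 2) μ₀ := hint (hwc.mul hmdc)
  have hImc : ∀ a, Integrable (fun ω => w ω * ‖mc ω a‖ ^ 2) μ₀ := fun a => hint (hwc.mul (hmcc a))
  have hw0 : ∀ ω, 0 < w ω := fun ω => Real.exp_pos _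
  have hεpos : 0 < ε := xy_dispersion_pos (M := M) k hk q
  have hmode : ∀ a : Fin 2, 4 * β * ε * ∫ ω, w ω * ‖mc ω a‖ ^ 2 ∂μ₀ ≤
      ((L : ℝ) ^ d * (M : ℝ) ^ d') * Z₀ := by
    intro a
    have := BirSliceXY.weighted_mode_bound_box hL hL4 hM hM4 ρ hKc hK hρ hβ k q hεpos a
    rw [BirSliceXY.card_boxTorus_real] at this
    exact this
  have hle : ∫ ω, w ω * ‖md ω‖ ^ 2 ∂μ₀ ≤
      2 * ∫ ω, w ω * ‖mc ω 0‖ ^ 2 ∂μ₀ + 2 * ∫ ω, w ω * ‖mc ω 1‖ ^ 2 ∂μ₀ := by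
    rw [← integral_const_mul, ← integral_const_mul,
      ← integral_add ((hImc 0).const_mul _) ((hImc 1).const_mul _)]
    refine integral_mono hImd (((hImc 0).const_mul _).add ((hImc 1).const_mul _)) fun ω => ?_
    have := BirSliceXY.norm_sq_mode_le ω (fun p => torusChar k p.1 * torusChar q p.2)
    have hw' := (hw0 ω).le
    simp only
    nlinarith
  have h2 : β * ε * ∫ ω, w ω * ‖md ω‖ ^ 2 ∂μ₀ ≤
      β * ε * (2 * ∫ ω, w ω * ‖mc ω 0‖ ^ 2 ∂μ₀ + 2 * ∫ ω, w ω * ‖mc ω 1‖ ^ 2 ∂μ₀) :=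
    mul_le_mul_of_nonneg_left hle (mul_nonneg hβ.le hεpos.le)
  linarith [hmode 0, hmode 1]

/-- **Infrared bound per space-time mode for the nearest-neighbour XY model on the angle cube of
`Λ = (ℤ/L)² × ℤ/M`** (`L, M ≥ 4` even, stiffness `J > 0`, `k ≠ 0`):
`(ε_L(k)+ε_M(q)) ∫_{[0,2π]^Λ} |Σ_s e^{iθ_s}χ_k(s₁)χ_q(s₂)|² e^{J·E(θ)} dθ ≤ (2L²M/J) ∫_{[0,2π]^Λ} e^{J·E(θ)} dθ`,
`E(θ) = Σ_s [cos(θ_s − θ_{s+e₁}) + cos(θ_s − θ_{s+e₂}) + cos(θ_s − θ_{s+e_τ})]` — `xy_modeBound_pi` through the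
angle/unit-vector dictionary and the relabelling `ℤ/M ≃ (ℤ/M)¹` of `BirSliceXYOrderRP` (`β = J/2`).
[cite: FriedliVelenik2017, Thm. 10.24 and §10.5.2] -/
theorem xy_modeBound_cube (J : ℝ) (hJ : 0 < J) (hLe : Even L) (hL4 : 4 ≤ L) (hMe : Even M) (hM4 : 4 ≤ M)
    (k : TorusSite 2 L) (hk : k ≠ 0) (q : TorusSite 1 M) :
    (dispersion (latticeMomentum L k) + dispersion (latticeMomentum M q)) *
        ∫ θ in cube L M, ‖∑ s : Λ L M, cexp (I * (θ s : ℂ)) * (torusChar k s.1 * torusChar q (fun _ => s.2))‖ ^ 2 *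
          Real.exp (J * ∑ s : Λ L M, (Real.cos (θ s - θ (s.1 + ![1, 0], s.2)) +
            Real.cos (θ s - θ (s.1 + ![0, 1], s.2)) + Real.cos (θ s - θ (s.1, s.2 + 1)))) ≤
      2 * ((L : ℝ) ^ 2 * M) / J * ∫ θ in cube L M, Real.exp (J * ∑ s : Λ L M,
          (Real.cos (θ s - θ (s.1 + ![1, 0], s.2)) + Real.cos (θ s - θ (s.1 + ![0, 1], s.2)) +
            Real.cos (θ s - θ (s.1, s.2 + 1)))) := by
  classical
  have hL3 : 3 ≤ L := by omega
  have hM3 : 3 ≤ M := by omega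
  have hβ : 0 < J / 2 := by linarith
  -- the single-spin law of the plane rotator
  set cs : ℝ → Fin 2 → ℝ := fun t => ![Real.cos t, Real.sin t] with hcs
  have hcsc : Continuous cs := PlaneRotator.continuous_cosSin
  set ρ : Measure (Fin 2 → ℝ) := Measure.map cs (volume.restrict (Set.Icc (0 : ℝ) (2 * Real.pi)))
    with hρ
  obtain ⟨Kc, hKc, hKρ⟩ := PlaneRotator.exists_isCompact_map_angleLaw (ν := 2) hcsc
  have hρ0 : ρ ≠ 0 := PlaneRotator.map_angleLaw_ne_zero hcsc.measurable
  -- the relabelling `(ℤ/L)² × ℤ/M ≃ (ℤ/L)² × (ℤ/M)¹`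
  obtain ⟨e, he⟩ := ir_exists_equiv L M
  have he1 : ∀ t : ZMod M, (fun _ : Fin 1 => t + 1) = (fun _ : Fin 1 => t) + Pi.single (0 : Fin 1) (1 : ZMod M) := by
    intro t; funext i; fin_cases i; simp
  -- the objects on the relabelled torus
  set μ₀ : Measure (TorusSite 2 L × TorusSite 1 M → Fin 2 → ℝ) :=
    Measure.pi fun _ : TorusSite 2 L × TorusSite 1 M => ρ with hμ₀
  set w : (TorusSite 2 L × TorusSite 1 M → Fin 2 → ℝ) → ℝ := fun ω =>
    Real.exp (-(J / 2) * NVector.vecGradForm (torusGraph 2 L □ torusGraph 1 M) ω ω) with hw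
  set md : (TorusSite 2 L × TorusSite 1 M → Fin 2 → ℝ) → ℂ := fun ω =>
    ∑ p : TorusSite 2 L × TorusSite 1 M,
      ((ω p 0 : ℂ) + (ω p 1 : ℂ) * I) * (torusChar k p.1 * torusChar q p.2) with hmd
  set EΛ : (TorusSite 2 L × TorusSite 1 M → ℝ) → ℝ := fun θ =>
    ∑ p : TorusSite 2 L × TorusSite 1 M,
      (Real.cos (θ p - θ (p.1 + ![1, 0], p.2)) + Real.cos (θ p - θ (p.1 + ![0, 1], p.2)) +
        Real.cos (θ p - θ (p.1, p.2 + Pi.single 0 1))) with hEΛ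
  set Z₀ : ℝ := ∫ ω, w ω ∂μ₀ with hZ₀
  set X₀ : ℝ := ∫ ω, w ω * ‖md ω‖ ^ 2 ∂μ₀ with hX₀
  set ε : ℝ := dispersion (latticeMomentum L k) + dispersion (latticeMomentum M q)
  -- Step 1: relabel both angle integrals
  have hrelZ : ∫ θ in cube L M, Real.exp (J * ∑ s : Λ L M, (Real.cos (θ s - θ (s.1 + ![1, 0], s.2)) +
        Real.cos (θ s - θ (s.1 + ![0, 1], s.2)) + Real.cos (θ s - θ (s.1, s.2 + 1)))) =
      ∫ θ in Set.pi Set.univ (fun _ : TorusSite 2 L × TorusSite 1 M => Set.Icc (0 : ℝ) (2 * Real.pi)),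
        Real.exp (J * EΛ θ) := by
    unfold cube
    rw [← BirSliceXY.setIntegral_cube_comp e]
    refine setIntegral_congr_fun (MeasurableSet.univ_pi fun _ => measurableSet_Icc) fun θ _ => ?_
    have hsum : ∑ s : Λ L M, (Real.cos (θ (e s) - θ (e (s.1 + ![1, 0], s.2))) +
        Real.cos (θ (e s) - θ (e (s.1 + ![0, 1], s.2))) + Real.cos (θ (e s) - θ (e (s.1, s.2 + 1)))) = EΛ θ := by
      rw [hEΛ]
      refine Fintype.sum_equiv e _ _ fun s => ?_
      simp only [he, he1]
    simp only [hsum]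
  have hrelX : ∫ θ in cube L M, ‖∑ s : Λ L M, cexp (I * (θ s : ℂ)) *
        (torusChar k s.1 * torusChar q (fun _ => s.2))‖ ^ 2 *
        Real.exp (J * ∑ s : Λ L M, (Real.cos (θ s - θ (s.1 + ![1, 0], s.2)) +
          Real.cos (θ s - θ (s.1 + ![0, 1], s.2)) + Real.cos (θ s - θ (s.1, s.2 + 1)))) =
      ∫ θ in Set.pi Set.univ (fun _ : TorusSite 2 L × TorusSite 1 M => Set.Icc (0 : ℝ) (2 * Real.pi)),
        ‖∑ p : TorusSite 2 L × TorusSite 1 M, cexp (I * (θ p : ℂ)) * (torusChar k p.1 * torusChar q p.2)‖ ^ 2 *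
          Real.exp (J * EΛ θ) := by
    unfold cube
    rw [← BirSliceXY.setIntegral_cube_comp e]
    refine setIntegral_congr_fun (MeasurableSet.univ_pi fun _ => measurableSet_Icc) fun θ _ => ?_
    have hsum : ∑ s : Λ L M, (Real.cos (θ (e s) - θ (e (s.1 + ![1, 0], s.2))) +
        Real.cos (θ (e s) - θ (e (s.1 + ![0, 1], s.2))) + Real.cos (θ (e s) - θ (e (s.1, s.2 + 1)))) = EΛ θ := by
      rw [hEΛ]
      refine Fintype.sum_equiv e _ _ fun s => ?_
      simp only [he, he1]
    have hmode : ∑ s : Λ L M, cexp (I * (θ (e s) : ℂ)) * (torusChar k s.1 * torusChar q (fun _ => s.2)) =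
        ∑ p : TorusSite 2 L × TorusSite 1 M, cexp (I * (θ p : ℂ)) * (torusChar k p.1 * torusChar q p.2) := by
      refine Fintype.sum_equiv e _ _ fun s => ?_
      simp only [he]
    simp only [hsum, hmode]
  -- Step 2: angles → unit vectors
  have hE : ∀ θ : TorusSite 2 L × TorusSite 1 M → ℝ,
      Real.exp (J * EΛ θ) = Real.exp (3 * ((L : ℝ) ^ 2 * M) * J) * w (fun p => cs (θ p)) := by
    intro θ
    rw [hw, hcs]
    simp only
    rw [BirSliceXY.vecGradForm_cosSin_box hL3 hM3 θ, ← Real.exp_add]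
    congr 1
    rw [hEΛ]
    ring
  have hMd : ∀ θ : TorusSite 2 L × TorusSite 1 M → ℝ,
      ‖∑ p : TorusSite 2 L × TorusSite 1 M, cexp (I * (θ p : ℂ)) * (torusChar k p.1 * torusChar q p.2)‖ ^ 2 =
        ‖md (fun p => cs (θ p))‖ ^ 2 := by
    intro θ
    rw [hmd, hcs]
    simp only [Matrix.cons_val_zero, Matrix.cons_val_one, Matrix.cons_val_fin_one]
    congr 2
    refine Finset.sum_congr rfl fun p _ => ?_
    rw [Complex.ofReal_cos, Complex.ofReal_sin, mul_comm I, Complex.exp_mul_I]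
  have hwc : Continuous w :=
    ((NVector.continuous_vecGradForm_self (G := torusGraph 2 L □ torusGraph 1 M)).const_mul (-(J / 2))).rexp
  have hmdc : Continuous fun ω => ‖md ω‖ ^ 2 := by rw [hmd]; fun_prop
  have hZeq : ∫ θ in Set.pi Set.univ (fun _ : TorusSite 2 L × TorusSite 1 M => Set.Icc (0 : ℝ) (2 * Real.pi)),
      Real.exp (J * EΛ θ) = Real.exp (3 * ((L : ℝ) ^ 2 * M) * J) * Z₀ := by
    simp_rw [hE]
    rw [integral_const_mul, hZ₀, hμ₀, hρ, BirSliceXY.integral_pi_map_angleLaw hcsc w hwc]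
  have hXeq : ∫ θ in Set.pi Set.univ (fun _ : TorusSite 2 L × TorusSite 1 M => Set.Icc (0 : ℝ) (2 * Real.pi)),
      ‖∑ p : TorusSite 2 L × TorusSite 1 M, cexp (I * (θ p : ℂ)) * (torusChar k p.1 * torusChar q p.2)‖ ^ 2 *
        Real.exp (J * EΛ θ) = Real.exp (3 * ((L : ℝ) ^ 2 * M) * J) * X₀ := by
    simp_rw [hE, hMd]
    have : ∀ θ : TorusSite 2 L × TorusSite 1 M → ℝ,
        ‖md (fun p => cs (θ p))‖ ^ 2 * (Real.exp (3 * ((L : ℝ) ^ 2 * M) * J) * w (fun p => cs (θ p))) =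
          Real.exp (3 * ((L : ℝ) ^ 2 * M) * J) * (w (fun p => cs (θ p)) * ‖md (fun p => cs (θ p))‖ ^ 2) := by
      intro θ; ring
    simp_rw [this]
    rw [integral_const_mul, hX₀, hμ₀, hρ,
      BirSliceXY.integral_pi_map_angleLaw hcsc (fun ω => w ω * ‖md ω‖ ^ 2) (hwc.mul hmdc)]
  -- Step 3: the infrared bound on the relabelled torus
  have hpi : J / 2 * ε * X₀ ≤ (L : ℝ) ^ 2 * (M : ℝ) ^ 1 * Z₀ :=
    xy_modeBound_pi (d := 2) (d' := 1) hLe hL4 hMe hM4 ρ hKc hKρ hρ0 hβ k hk q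
  rw [pow_one] at hpi
  -- Step 4: arithmetic
  rw [hrelZ, hrelX, hZeq, hXeq]
  have hexp : 0 < Real.exp (3 * ((L : ℝ) ^ 2 * M) * J) := Real.exp_pos _
  have h1 : ε * X₀ ≤ 2 * ((L : ℝ) ^ 2 * M) / J * Z₀ := by
    rw [div_mul_eq_mul_div, le_div_iff₀ hJ]
    nlinarith
  calc ε * (Real.exp (3 * ((L : ℝ) ^ 2 * M) * J) * X₀)
      = Real.exp (3 * ((L : ℝ) ^ 2 * M) * J) * (ε * X₀) := by ring
    _ ≤ Real.exp (3 * ((L : ℝ) ^ 2 * M) * J) * (2 * ((L : ℝ) ^ 2 * M) / J * Z₀) :=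
        mul_le_mul_of_nonneg_left h1 hexp.le
    _ = 2 * ((L : ℝ) ^ 2 * M) / J * (Real.exp (3 * ((L : ℝ) ^ 2 * M) * J) * Z₀) := by ring

end ModeBound

section XYWitness

variable {L M : ℕ} [NeZero L] [NeZero M]

/-- The generating function of the XY witness table `witness 0 0` is the real twelve-edge window energy `S12`.
[folklore] -/
theorem xyw_genF (φ : W 2 → ℝ) : genF (witness 0 0) φ = ((S12 φ : ℝ) : ℂ) := by
  simp only [witness, spatialTab, temporalCosTab, temporalSinTab, spatialEdges, temporalEdges,
    List.map_cons, List.map_nil, List.sum_cons, List.sum_nil, genF_add, genF_smul,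
    genF_cosTab, genF_sinTab, vx, S12, add_zero, Complex.ofReal_zero, mul_zero, zero_mul, one_mul]
  push_cast
  ring

omit [NeZero L] [NeZero M] in
/-- Window shifts are translations of the torus: `Σ_s F(sh s v) = Σ_s F(s)`. [folklore] -/
theorem xyw_sum_sh {r : ℕ} [NeZero L] [NeZero M] (v : W r) (F : Λ L M → ℝ) :
    ∑ s : Λ L M, F (sh L M s v) = ∑ s : Λ L M, F s :=
  Fintype.sum_equiv (Equiv.addRight ((![((v.1 : ℕ) : ZMod L), ((v.2.1 : ℕ) : ZMod L)], ((v.2.2 : ℕ) : ZMod M)) : Λ L M))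
    _ _ (fun _ => rfl)

/-- **The summed window energy of the XY witness counts every nearest-neighbour bond four times**:
`Σ_s S12(θ ∘ sh s) = 12·L²M − 4·Σ_s [cos(θ_s − θ_{s+e₁}) + cos(θ_s − θ_{s+e₂}) + cos(θ_s − θ_{s+e_τ})]`. [folklore] -/
theorem xyw_sum_S12 (θ : Λ L M → ℝ) :
    ∑ s : Λ L M, S12 (fun w => θ (sh L M s w)) =
      12 * ((L : ℝ) ^ 2 * M) - 4 * ∑ s : Λ L M, (Real.cos (θ s - θ (s.1 + ![1, 0], s.2)) +
        Real.cos (θ s - θ (s.1 + ![0, 1], s.2)) + Real.cos (θ s - θ (s.1, s.2 + 1))) := by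
  -- the three per-direction reductions of a window edge sum to a bond sum
  have hX : ∀ u v : W 2, (∀ s : Λ L M, sh L M s u = ((sh L M s v).1 + ![1, 0], (sh L M s v).2)) →
      ∑ s : Λ L M, (1 - Real.cos (θ (sh L M s u) - θ (sh L M s v))) =
        ∑ s : Λ L M, (1 - Real.cos (θ s - θ (s.1 + ![1, 0], s.2))) := by
    intro u v h
    calc ∑ s : Λ L M, (1 - Real.cos (θ (sh L M s u) - θ (sh L M s v)))
        = ∑ s : Λ L M, (1 - Real.cos (θ ((sh L M s v).1 + ![1, 0], (sh L M s v).2) - θ (sh L M s v))) :=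
          Finset.sum_congr rfl fun s _ => by rw [h s]
      _ = ∑ s : Λ L M, (1 - Real.cos (θ (s.1 + ![1, 0], s.2) - θ s)) :=
          xyw_sum_sh v (fun p => 1 - Real.cos (θ (p.1 + ![1, 0], p.2) - θ p))
      _ = _ := Finset.sum_congr rfl fun s _ => by rw [cos_sub_comm']
  have hY : ∀ u v : W 2, (∀ s : Λ L M, sh L M s u = ((sh L M s v).1 + ![0, 1], (sh L M s v).2)) →
      ∑ s : Λ L M, (1 - Real.cos (θ (sh L M s u) - θ (sh L M s v))) =
        ∑ s : Λ L M, (1 - Real.cos (θ s - θ (s.1 + ![0, 1], s.2))) := by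
    intro u v h
    calc ∑ s : Λ L M, (1 - Real.cos (θ (sh L M s u) - θ (sh L M s v)))
        = ∑ s : Λ L M, (1 - Real.cos (θ ((sh L M s v).1 + ![0, 1], (sh L M s v).2) - θ (sh L M s v))) :=
          Finset.sum_congr rfl fun s _ => by rw [h s]
      _ = ∑ s : Λ L M, (1 - Real.cos (θ (s.1 + ![0, 1], s.2) - θ s)) :=
          xyw_sum_sh v (fun p => 1 - Real.cos (θ (p.1 + ![0, 1], p.2) - θ p))
      _ = _ := Finset.sum_congr rfl fun s _ => by rw [cos_sub_comm']
  have hT : ∀ u v : W 2, (∀ s : Λ L M, sh L M s u = ((sh L M s v).1, (sh L M s v).2 + 1)) →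
      ∑ s : Λ L M, (1 - Real.cos (θ (sh L M s u) - θ (sh L M s v))) =
        ∑ s : Λ L M, (1 - Real.cos (θ s - θ (s.1, s.2 + 1))) := by
    intro u v h
    calc ∑ s : Λ L M, (1 - Real.cos (θ (sh L M s u) - θ (sh L M s v)))
        = ∑ s : Λ L M, (1 - Real.cos (θ ((sh L M s v).1, (sh L M s v).2 + 1) - θ (sh L M s v))) :=
          Finset.sum_congr rfl fun s _ => by rw [h s]
      _ = ∑ s : Λ L M, (1 - Real.cos (θ (s.1, s.2 + 1) - θ s)) :=
          xyw_sum_sh v (fun p => 1 - Real.cos (θ (p.1, p.2 + 1) - θ p))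
      _ = _ := Finset.sum_congr rfl fun s _ => by rw [cos_sub_comm']
  -- window geometry of the twelve cube edges
  have gx : ∀ b t : Fin 2, ∀ s : Λ L M, sh L M s ((1 : Fin 2), b, t) =
      ((sh L M s ((0 : Fin 2), b, t)).1 + ![1, 0], (sh L M s ((0 : Fin 2), b, t)).2) := by
    intro b t s
    refine Prod.ext ?_ rfl
    funext i; fin_cases i <;> simp [sh]
  have gy : ∀ a t : Fin 2, ∀ s : Λ L M, sh L M s (a, (1 : Fin 2), t) =
      ((sh L M s (a, (0 : Fin 2), t)).1 + ![0, 1], (sh L M s (a, (0 : Fin 2), t)).2) := by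
    intro a t s
    refine Prod.ext ?_ rfl
    funext i; fin_cases i <;> simp [sh]
  have gt : ∀ a b : Fin 2, ∀ s : Λ L M, sh L M s (a, b, (1 : Fin 2)) =
      ((sh L M s (a, b, (0 : Fin 2))).1, (sh L M s (a, b, (0 : Fin 2))).2 + 1) := by
    intro a b s
    refine Prod.ext rfl ?_
    simp [sh]
  have hcard : (Fintype.card (Λ L M) : ℝ) = (L : ℝ) ^ 2 * M := by
    simp [TorusSite, ZMod.card, Fintype.card_prod]
  simp only [S12, Finset.sum_add_distrib]
  rw [hX _ _ (gx 0 0), hX _ _ (gx 0 1), hX _ _ (gx 1 0), hX _ _ (gx 1 1),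
    hY _ _ (gy 0 0), hY _ _ (gy 0 1), hY _ _ (gy 1 0), hY _ _ (gy 1 1),
    hT _ _ (gt 0 0), hT _ _ (gt 0 1), hT _ _ (gt 1 0), hT _ _ (gt 1 1)]
  simp only [Finset.sum_sub_distrib, Finset.sum_const, Finset.card_univ, nsmul_eq_mul, hcard]
  ring

/-- **The Boltzmann factor of the XY witness is the XY Gibbs factor at stiffness `4K`**:
`e^{−A(θ)} = e^{−12KL²M} · e^{4K·E(θ)}` (a positive real). [folklore] -/
theorem xyw_cexp_neg_action (K : ℝ) (θ : Λ L M → ℝ) :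
    Complex.exp (-(action K (witness 0 0) L M θ)) =
      ((Real.exp (-(12 * ((L : ℝ) ^ 2 * M) * K)) * Real.exp ((4 * K) * ∑ s : Λ L M,
        (Real.cos (θ s - θ (s.1 + ![1, 0], s.2)) + Real.cos (θ s - θ (s.1 + ![0, 1], s.2)) +
          Real.cos (θ s - θ (s.1, s.2 + 1)))) : ℝ) : ℂ) := by
  rw [action]
  simp_rw [xyw_genF]
  rw [← Complex.ofReal_sum, xyw_sum_S12, ← Real.exp_add, Complex.ofReal_exp]
  congr 1
  push_cast
  ring

/-- **S5b calibrated on the XY table.**  For the S5b-admissible (`witness_admissible`, `B = 128`, `c₀ = 1/18`)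
nearest-neighbour XY window table `c = witness 0 0` (`r = 2`) of `Theorems.BirComplexStableXY.Negative.WitnessTable`,
every `K > 0`, all even `L, M ≥ 4`, every spatial momentum `k ≠ 0` and temporal momentum `q`, the crux's complex measure
obeys the INFRARED BOUND per space-time mode of stub `stub_complexInfraredBound` with the `K`-, `L`-, `M`-independent
constant `C = c₀/2`:
`Re ∫_{[0,2π]^Λ} |Σ_s e^{iθ_s}χ_k(s₁)χ_q(s₂)|² e^{−A} ≤ L²M/(2K(ε_L(k)+ε_M(q))) · Re Z`.
Fröhlich–Simon–Spencer reflection positivity / Gaussian domination on the anisotropic torus (`xy_modeBound_cube` at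
`J = 4K`) and the dictionary `xyw_cexp_neg_action`. [cite: FrohlichSimonSpencer1976, Thm. 3.1; FriedliVelenik2017, Thm. 10.24] -/
theorem xyWitness_complexInfraredBound : ∀ K : ℝ, 0 < K → ∀ (L M : ℕ) [NeZero L] [NeZero M], 4 ≤ L → 4 ≤ M → Even L → Even M → ∀ k ∈ Finset.univ.erase (0 : TorusSite 2 L), ∀ q : TorusSite 1 M, (∫ θ in cube L M, (((‖∑ s : Λ L M, Complex.exp (Complex.I * (θ s : ℂ)) * (torusChar k s.1 * torusChar q (fun _ => s.2))‖ ^ 2 : ℝ)) : ℂ) * Complex.exp (-(action K (witness 0 0) L M θ))).re ≤ ((L : ℝ) ^ 2 * M) / (2 * K * (dispersion (latticeMomentum L k) + dispersion (latticeMomentum M q))) * (partZ K (witness 0 0) L M).re := by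
  intro K hK L M _ _ hL4 hM4 hLe hMe k hk q
  have hk0 : k ≠ 0 := Finset.ne_of_mem_erase hk
  have hε := xy_dispersion_pos (M := M) k hk0 q
  set ε : ℝ := dispersion (latticeMomentum L k) + dispersion (latticeMomentum M q)
  set E : (Λ L M → ℝ) → ℝ := fun θ => ∑ s : Λ L M, (Real.cos (θ s - θ (s.1 + ![1, 0], s.2)) +
    Real.cos (θ s - θ (s.1 + ![0, 1], s.2)) + Real.cos (θ s - θ (s.1, s.2 + 1))) with hE
  set a : ℝ := Real.exp (-(12 * ((L : ℝ) ^ 2 * M) * K)) with ha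
  set Md : (Λ L M → ℝ) → ℝ := fun θ =>
    ‖∑ s : Λ L M, cexp (I * (θ s : ℂ)) * (torusChar k s.1 * torusChar q (fun _ => s.2))‖ ^ 2 with hMd
  set X : ℝ := ∫ θ in cube L M, Md θ * Real.exp ((4 * K) * E θ) with hX
  set Z : ℝ := ∫ θ in cube L M, Real.exp ((4 * K) * E θ) with hZ
  -- the weight is real: both integrals are real numbers
  have hw : ∀ θ : Λ L M → ℝ, cexp (-(action K (witness 0 0) L M θ)) =
      ((a * Real.exp ((4 * K) * E θ) : ℝ) : ℂ) := fun θ => xyw_cexp_neg_action K θ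
  have hnum : (∫ θ in cube L M, ((Md θ : ℝ) : ℂ) * cexp (-(action K (witness 0 0) L M θ))) =
      ((a * X : ℝ) : ℂ) := by
    simp_rw [hw]
    have h1 : (∫ θ in cube L M, ((Md θ : ℝ) : ℂ) * ((a * Real.exp ((4 * K) * E θ) : ℝ) : ℂ)) =
        ∫ θ in cube L M, ((a * (Md θ * Real.exp ((4 * K) * E θ)) : ℝ) : ℂ) :=
      integral_congr_ae (Filter.Eventually.of_forall fun θ => by push_cast; ring)
    have h2 : (∫ θ in cube L M, ((a * (Md θ * Real.exp ((4 * K) * E θ)) : ℝ) : ℂ)) =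
        ((∫ θ in cube L M, a * (Md θ * Real.exp ((4 * K) * E θ)) : ℝ) : ℂ) := integral_ofReal
    rw [h1, h2, integral_const_mul]
  have hden : partZ K (witness 0 0) L M = ((a * Z : ℝ) : ℂ) := by
    unfold partZ
    simp_rw [hw]
    have h2 : (∫ θ in cube L M, ((a * Real.exp ((4 * K) * E θ) : ℝ) : ℂ)) =
        ((∫ θ in cube L M, a * Real.exp ((4 * K) * E θ) : ℝ) : ℂ) := integral_ofReal
    rw [h2, integral_const_mul]
  rw [hnum, hden, Complex.ofReal_re, Complex.ofReal_re]
  -- the XY infrared bound at stiffness `J = 4K`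
  have hJ : 0 < 4 * K := by linarith
  have hcube : ε * X ≤ 2 * ((L : ℝ) ^ 2 * M) / (4 * K) * Z :=
    xy_modeBound_cube (4 * K) hJ hLe hL4 hMe hM4 k hk0 q
  have ha0 : 0 < a := Real.exp_pos _
  have hX' : X ≤ ((L : ℝ) ^ 2 * M) / (2 * K * ε) * Z := by
    rw [div_mul_eq_mul_div, le_div_iff₀ (by positivity)]
    have : 2 * ((L : ℝ) ^ 2 * M) / (4 * K) * Z = ((L : ℝ) ^ 2 * M) * Z / (2 * K) := by
      field_simp; ring
    rw [this, le_div_iff₀ (by positivity)] at hcube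
    nlinarith
  calc a * X ≤ a * (((L : ℝ) ^ 2 * M) / (2 * K * ε) * Z) := mul_le_mul_of_nonneg_left hX' ha0.le
    _ = ((L : ℝ) ^ 2 * M) / (2 * K * ε) * (a * Z) := by ring

end XYWitness

end Summit.HubbardSuperconductivity.HubbardSuperconductivity.Theorems

end
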